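import Summits.HodgeConjecture.HodgeConjecture.Theorems.Ring2WeilCoverageCMFieldRationalPrimeRule
import HarnessLib

/-!
# Ring 2 — Weil-family coverage, CM-field rows: THE SPLIT RATIONAL PRIMES on a quadratic carrier with an
  ARBITRARY radicand — `[ℓ] ≠ [1] ⟺` a root of `R` mod `ℓ` is a non-square mod `ℓ`
  (WEIL-FAMILY-COVERAGE «## b03», cell (xxi‴), part 22)

research route conditional on HC_CM; not a corollary; Q11.4-sentence-2 already refuted in dim ≥ 3.

Deligne's quadratic carriers `R = S² + pS + q` present a quartic CM field `E = F(√θ)` over the real quadratic field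
`F = ℚ[S]/(R) = ℚ(θ)` [cite: Deligne1982HodgeCycles, §4 p. 30]; the rows `W_{2k}.E.δ` of the census tables are the
classes `δ ∈ F^×/Nm_{E/F}(E^×)`, labelled by the `T`-sets `T(q) = {𝔭 : (q, θ)_𝔭 = -1}` of parts 1–11
[cite: Deligne1982HodgeCycles, §4 (1), Cor. 4.2].  Part 14 settled the RATIONAL PRIME RULE for the fifteen carriers
with a RATIONAL radicand (`θ = c²·b₀`, `b₀ ∈ ℤ`: the biquadratic fields) and part 21 the INERT primes of every carrier.
THIS FILE treats the primes `ℓ` SPLIT in `F` for an ARBITRARY carrier (radicand `θ` itself), which is what the five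
CYCLIC quartic CM fields of the census need (`ℚ(ζ₅)`, `ℚ(√-(2+√2))`, `ℚ(√-3(2+√2))`, `ℚ(√-(5+√5))`, `ℚ(√-3(5+√5)/2)`:
there `θ` is divisible by the ramified prime `(√d)` to an odd power, so no rational radicand exists):

* §55 tools: the `T`-membership of a non-dyadic place at which the FIRST argument is a unit (O'Meara 63:11a, the
  symmetric form of part 12 (b)); the places dividing `θ` divide `q`; a radicand prime `p₀` with `ℓ` a square mod
  `p₀` is harmless for `ℓ`.
* §56 **THEOREM (split rational primes).** `F` with ONE dyadic place, the odd places dividing `θ` harmless for `ℓ`;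
  `ℓ` an odd prime with `ℓ ∤ q·(p² - 4q)` and `p² - 4q` a square mod `ℓ` (`ℓ` splits in `F`).  Then
  **`[ℓ] ≠ [(-1)^k]` (`k` even) ⟺ some root `r̄ ∈ 𝔽_ℓ` of `R̄` is a NON-square in `𝔽_ℓ`** — the degree-one place
  `𝔭 = (ℓ, θ - r)` has `𝓞_F/𝔭 = 𝔽_ℓ ∋ θ̄ = r̄`, and `𝔭 ∈ T(ℓ)` iff `θ̄` is a non-square there (O'Meara 63:12).
* §57 the forms used by the instances: if every root of `R̄` has the same quadratic character `P` (the Galois carriers: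
  `r̄₁ r̄₂ = q̄` is a square mod a split `ℓ`), then **`[ℓ] ≠ [(-1)^k] ⟺ ¬P`**; and the «all roots» form.
The sequel computes `P` as a congruence on `ℓ` for the cyclic carriers (`2 + √2` is a square mod `v ∣ ℓ` iff
`ℓ ≡ ±1 (mod 16)`; the roots of `S² + 5S + 5` are squares mod `ℓ` iff `ℓ ≡ 1 (mod 5)`).
No new definition, no named fact, no sorry; nothing about the Hodge conjecture is asserted.
-/

noncomputable section

set_option linter.dupNamespace false

open Polynomial NumberField IsDedekindDomain

namespace Summit.HodgeConjecture.HodgeConjecture.Ring2.WeilCoverageCM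

open Literature.AlgebraicGeometry.Deligne1982
open Literature.AlgebraicGeometry.HodgeTheory (splitDiscriminantClassCM)
open Literature.NumberTheory.QuadraticForms

variable {R : Polynomial ℤ} [Fact (Irreducible (cmPolyQ R))] [Fact (Irreducible (realPolyQ R))]

/-! ### §55 Tools: unit first argument; places of `θ` divide `q`; radicand primes with `ℓ` a square -/

/-- **A non-dyadic place at which the first argument is a UNIT** (`θ = c²·b`, `u ∈ 𝓞_F ∖ v`): `v ∈ T(u)` iff `u` is a
non-square mod `v` AND `ord_v b` is odd — the symbol `(u, θ)_v = (b, u)_v` of `b` against the unit `u`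
(O'Meara 63:11a; the symmetric form of part 12 (b), both directions). [cite: Omeara1963, §63B Cor. 63:11a and
Example 63:12] [cite: Deligne1982HodgeCycles, §4 (1)] -/
theorem inl_mem_badPlaces_coe_iff_of_notMem {c : realField R} {b : 𝓞 (realField R)}
    (hfac : AdjoinRoot.root (realPolyQ R) = c ^ 2 * (b : realField R)) (v : HeightOneSpectrum (𝓞 (realField R)))
    (h2 : (2 : 𝓞 (realField R)) ∉ v.asIdeal) {u : 𝓞 (realField R)} (hu : u ∉ v.asIdeal) :
    Sum.inl v ∈ badPlaces ((u : 𝓞 (realField R)) : realField R) (AdjoinRoot.root (realPolyQ R)) ↔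
      ¬ IsSquare (Ideal.Quotient.mk v.asIdeal u) ∧
        Odd (WithZero.log (v.valuation (realField R) (b : realField R))) := by
  have hb0 : (b : realField R) ≠ 0 := right_ne_zero_of_root_eq_sq_mul hfac
  rw [mem_badPlaces_iff, placeSymbol_inl, hilbertSymbol_adicCompletion_root_eq_of_eq_sq_mul hfac v, hilbertSymbol_comm]
  have hu' : algebraMap (realField R) (v.adicCompletion (realField R)) ((u : 𝓞 (realField R)) : realField R) =
      algebraMap (𝓞 (realField R)) (v.adicCompletion (realField R)) u :=
    (IsScalarTower.algebraMap_apply (𝓞 (realField R)) (realField R) (v.adicCompletion (realField R)) u).symm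
  have hb' : algebraMap (𝓞 (realField R)) (v.adicCompletion (realField R)) b =
      algebraMap (realField R) (v.adicCompletion (realField R)) (b : realField R) :=
    IsScalarTower.algebraMap_apply (𝓞 (realField R)) (realField R) (v.adicCompletion (realField R)) b
  have hbne : algebraMap (𝓞 (realField R)) (v.adicCompletion (realField R)) b ≠ 0 := by
    rw [hb']; exact (_root_.map_ne_zero _).2 hb0
  rw [hu', hilbertSymbol_eq_neg_one_iff_not_isSquare_and_odd (realField R) v h2 hu hbne]
  have e1 : IsSquare (algebraMap (𝓞 (realField R)) (v.adicCompletion (realField R)) u) ↔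
      IsSquare (Ideal.Quotient.mk v.asIdeal u) :=
    isSquare_algebraMap_adicCompletion_iff (realField R) v h2 hu
  have e2 : Valued.v (algebraMap (𝓞 (realField R)) (v.adicCompletion (realField R)) b) =
      v.valuation (realField R) (b : realField R) := by
    rw [hb']; exact HeightOneSpectrum.valuedAdicCompletion_eq_valuation' v (b : realField R)
  rw [e2]
  exact and_congr (not_congr e1) Iff.rfl

/-- Hence, for a `v`-unit `u ∈ 𝓞_F` (`v ∤ 2`) that is a non-square mod `v`, with `ord_v b` odd: **`[u] ≠ [(-1)^k]`**
(`k` even). [cite: Deligne1982HodgeCycles, §4 (1) and Cor. 4.2] [cite: Omeara1963, §63B Cor. 63:11a] -/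
theorem mk_coe_ne_splitDiscriminantClassCM_of_notMem {c : realField R} {b : 𝓞 (realField R)}
    (hfac : AdjoinRoot.root (realPolyQ R) = c ^ 2 * (b : realField R)) (v : HeightOneSpectrum (𝓞 (realField R)))
    (h2 : (2 : 𝓞 (realField R)) ∉ v.asIdeal) {u : 𝓞 (realField R)} (hu : u ∉ v.asIdeal)
    (hns : ¬ IsSquare (Ideal.Quotient.mk v.asIdeal u))
    (hodd : Odd (WithZero.log (v.valuation (realField R) (b : realField R))))
    (qu : (realField R)ˣ) (hqu : (qu : realField R) = ((u : 𝓞 (realField R)) : realField R)) {k : ℕ} (hk : Even k) :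
    (QuotientGroup.mk qu : cmNormResidueGroup R) ≠ splitDiscriminantClassCM R k := by
  rw [Ne, mk_eq_splitDiscriminantClassCM_iff_badPlaces_eq_empty qu hk, hqu, Set.eq_empty_iff_forall_notMem]
  exact fun h ↦ h (Sum.inl v) ((inl_mem_badPlaces_coe_iff_of_notMem hfac v h2 hu).2 ⟨hns, hodd⟩)

omit [Fact (Irreducible (cmPolyQ R))] in
/-- **The places dividing `θ` divide `q`** (`θ(θ + p) = -q` on `R = S² + pS + q`). [cite: Deligne1982HodgeCycles, §4 p. 30] -/
theorem intCast_mem_of_root_mem {p q : ℤ} (hR : R = X ^ 2 + C p * X + C q) {θₒ : 𝓞 (realField R)}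
    (hθ : (θₒ : realField R) = AdjoinRoot.root (realPolyQ R)) (v : HeightOneSpectrum (𝓞 (realField R)))
    (h : θₒ ∈ v.asIdeal) : (q : 𝓞 (realField R)) ∈ v.asIdeal := by
  have hrel := ringOfIntegers_root_rel_quadratic hR hθ
  have e : (q : 𝓞 (realField R)) = -(θₒ * (θₒ + p)) := by linear_combination hrel
  rw [e]
  exact v.asIdeal.neg_mem (v.asIdeal.mul_mem_right _ h)

omit [Fact (Irreducible (cmPolyQ R))] in
/-- **A radicand prime `p₀` modulo which `ℓ` is a square is harmless for `ℓ`**: at every place `v ∋ p₀` of the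
quadratic field `F`, `ℓ ∉ v` (`ℓ ≠ p₀` primes) and `ℓ` is a square mod `v` — at `N v = p₀` because it is one mod `p₀`,
at `N v = p₀²` because every integer is. [folklore] -/
theorem radicand_places_of_isSquare_mod (hK : Module.finrank ℚ (realField R) = 2) {p₀ : ℕ} (hp₀ : p₀.Prime)
    {ℓ : ℕ} (hℓ : ℓ.Prime) (hℓp : ℓ ≠ p₀) (hsq : IsSquare ((ℓ : ℤ) : ZMod p₀))
    (v : HeightOneSpectrum (𝓞 (realField R))) (hpv : (p₀ : 𝓞 (realField R)) ∈ v.asIdeal) :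
    (ℓ : 𝓞 (realField R)) ∉ v.asIdeal ∧ IsSquare (Ideal.Quotient.mk v.asIdeal (ℓ : 𝓞 (realField R))) := by
  refine ⟨?_, ?_⟩
  · have hcop : IsCoprime (p₀ : ℤ) ℓ := by
      rw [Int.isCoprime_iff_gcd_eq_one, Int.gcd_natCast_natCast]
      exact (Nat.coprime_primes hp₀ hℓ).2 (Ne.symm hℓp)
    have := intCast_notMem_of_isCoprime v hcop (by push_cast; exact hpv)
    push_cast at this
    exact this
  · rcases absNorm_eq_or_eq_sq_of_natCast_mem hK v hp₀ hpv with h | h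
    · have := (isSquare_intCast_residue_iff_of_absNorm_eq v hp₀ h ℓ).2 hsq
      push_cast at this
      exact this
    · have := isSquare_intCast_residue_of_absNorm_eq_sq v hp₀ h ℓ
      push_cast at this
      exact this

/-! ### §56 THE SPLIT RATIONAL PRIMES: `[ℓ] ≠ [1]` iff a root of `R` mod `ℓ` is a non-square mod `ℓ` -/

/-- **THEOREM (split rational primes, arbitrary radicand).** `R = S² + pS + q` (`θ` a root, `E = F(√θ)`), `F` with ONE
dyadic place, the odd places dividing `θ` harmless for `ℓ` (prime to `ℓ`, with `ℓ` a square there or `ord θ` even);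
`ℓ` an odd prime, `ℓ ∤ q`, `ℓ ∤ p² - 4q`, and `p² - 4q` a square mod `ℓ`.  Then **`[ℓ] ≠ [(-1)^k]` (`k` even) iff
some root `r̄` of `S² + pS + q` in `𝔽_ℓ` is a NON-square in `𝔽_ℓ`** («a degree-one place over `ℓ` is inert in
`E = F(√θ)`»). (⟹: the odd bad place `v ∋ ℓ` of part 12 has `2θ̄ + p = ±s̄`, so `θ̄ = r̄` for an integer `r`; `r̄`
non-square mod `v` forces `N v = ℓ`, i.e. `r̄` non-square mod `ℓ`, and `R(r) ∈ v ∩ ℤ = ℓℤ`.  ⟸: lift `r̄` with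
`ℓ ∥ R(r)`; `𝔭 = (ℓ, θ - r)` is a degree-one place with `ord_𝔭 ℓ = 1` (part 13) at which `θ ≡ r` is a non-square.)
[cite: Deligne1982HodgeCycles, §4 (1) and Cor. 4.2] [cite: Omeara1963, §63B Example 63:12 and §71D Thm. 71:18] -/
theorem mk_natCast_ne_splitDiscriminantClassCM_iff_exists_root_not_isSquare {p q : ℤ}
    (hR : R = X ^ 2 + C p * X + C q)
    (hroots : ∀ s : ℂ, Polynomial.eval₂ (Int.castRingHom ℂ) s R = 0 → s.im = 0 ∧ s.re < 0)
    {θₒ : 𝓞 (realField R)} (hθ : (θₒ : realField R) = AdjoinRoot.root (realPolyQ R))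
    (huniq : ∀ v v' : HeightOneSpectrum (𝓞 (realField R)),
      (2 : 𝓞 (realField R)) ∈ v.asIdeal → (2 : 𝓞 (realField R)) ∈ v'.asIdeal → v = v')
    {ℓ : ℕ} (hℓ : ℓ.Prime) (hℓ2 : ℓ ≠ 2) (hℓq : ¬ (ℓ : ℤ) ∣ q) (hdisc : ¬ (ℓ : ℤ) ∣ p ^ 2 - 4 * q)
    (hdsq : IsSquare ((p ^ 2 - 4 * q : ℤ) : ZMod ℓ))
    (hb : ∀ v : HeightOneSpectrum (𝓞 (realField R)), (2 : 𝓞 (realField R)) ∉ v.asIdeal → θₒ ∈ v.asIdeal →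
      (ℓ : 𝓞 (realField R)) ∉ v.asIdeal ∧
        (IsSquare (Ideal.Quotient.mk v.asIdeal (ℓ : 𝓞 (realField R))) ∨
          ¬ Odd (WithZero.log (v.valuation (realField R) ((θₒ : 𝓞 (realField R)) : realField R)))))
    (qℓ : (realField R)ˣ) (hqℓ : (qℓ : realField R) = ℓ) {k : ℕ} (hk : Even k) :
    (QuotientGroup.mk qℓ : cmNormResidueGroup R) ≠ splitDiscriminantClassCM R k ↔
      ∃ r : ZMod ℓ, r ^ 2 + (p : ZMod ℓ) * r + (q : ZMod ℓ) = 0 ∧ ¬ IsSquare r := by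
  haveI := Fact.mk hℓ
  have hK := finrank_realField_quadratic hR
  have hrel := ringOfIntegers_root_rel_quadratic hR hθ
  have hℓZ : Prime (ℓ : ℤ) := Nat.prime_iff_prime_int.1 hℓ
  obtain ⟨m, hm⟩ := hℓ.eq_two_or_odd'.resolve_left hℓ2
  have hfac : AdjoinRoot.root (realPolyQ R) = (1 : realField R) ^ 2 * ((θₒ : 𝓞 (realField R)) : realField R) := by
    rw [one_pow, one_mul, hθ]
  rw [mk_natCast_ne_splitDiscriminantClassCM_iff hroots hfac huniq hℓ hb qℓ hqℓ hk]
  constructor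
  · rintro ⟨v, h2, hθv, hns, hodd⟩
    have hℓv : (ℓ : 𝓞 (realField R)) ∈ v.asIdeal := natCast_mem_of_odd_log_valuation v hodd
    have hℓv' : ((ℓ : ℤ) : 𝓞 (realField R)) ∈ v.asIdeal := by push_cast; exact hℓv
    -- an integer `s` with `s² ≡ p² - 4q`, and a sign with `2θ + p ≡ s (mod v)`
    obtain ⟨s₀, hs₀⟩ := hdsq
    obtain ⟨s₁, rfl⟩ := ZMod.intCast_surjective s₀
    have hsd₁ : (ℓ : ℤ) ∣ s₁ * s₁ - (p ^ 2 - 4 * q) := by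
      rw [← ZMod.intCast_zmod_eq_zero_iff_dvd]; push_cast; rw [← hs₀]; push_cast; ring
    obtain ⟨s, hsd, hsv⟩ : ∃ s : ℤ, (ℓ : ℤ) ∣ s * s - (p ^ 2 - 4 * q) ∧ (2 * θₒ + p - s : 𝓞 (realField R)) ∈ v.asIdeal := by
      obtain ⟨n, hn⟩ := hsd₁
      have hprod : (2 * θₒ + p - s₁ : 𝓞 (realField R)) * (2 * θₒ + p + s₁) ∈ v.asIdeal := by
        have e : (2 * θₒ + p - s₁ : 𝓞 (realField R)) * (2 * θₒ + p + s₁) =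
            4 * (θₒ ^ 2 + p * θₒ + q) - ((s₁ * s₁ - (p ^ 2 - 4 * q) : ℤ) : 𝓞 (realField R)) := by
          push_cast; ring
        rw [e, hrel, hn, mul_zero, zero_sub]
        push_cast
        exact v.asIdeal.neg_mem (v.asIdeal.mul_mem_right _ hℓv')
      rcases v.isPrime.mem_or_mem hprod with h | h
      · exact ⟨s₁, ⟨n, hn⟩, h⟩
      · refine ⟨-s₁, ⟨n, by rw [← hn]; ring⟩, ?_⟩
        push_cast; rwa [sub_neg_eq_add]
    -- `r = (s - p)/2 mod ℓ`: `θ ≡ r (mod v)`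
    set r : ℤ := (m + 1) * (s - p) with hr
    have h2r : (ℓ : ℤ) ∣ 2 * r + p - s := ⟨s - p, by rw [hr, hm]; push_cast; ring⟩
    have hθr : (θₒ - r : 𝓞 (realField R)) ∈ v.asIdeal := by
      have h2θr : (2 : 𝓞 (realField R)) * (θₒ - r) ∈ v.asIdeal := by
        obtain ⟨n, hn⟩ := h2r
        have e : (2 : 𝓞 (realField R)) * (θₒ - r) = (2 * θₒ + p - s) - ((2 * r + p - s : ℤ) : 𝓞 (realField R)) := by
          push_cast; ring
        rw [e, hn]
        push_cast
        exact v.asIdeal.sub_mem hsv (v.asIdeal.mul_mem_right _ hℓv')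
      exact ((v.isPrime.mem_or_mem h2θr).resolve_left h2)
    have hmk : Ideal.Quotient.mk v.asIdeal θₒ = Ideal.Quotient.mk v.asIdeal (r : 𝓞 (realField R)) := by
      rw [Ideal.Quotient.eq]; exact hθr
    -- `N v = ℓ` (at `N v = ℓ²` the integer `r` would be a square mod `v`)
    have hN : Ideal.absNorm v.asIdeal = ℓ := by
      rcases absNorm_eq_or_eq_sq_of_natCast_mem hK v hℓ hℓv with h | h
      · exact h
      · exact absurd (hmk ▸ isSquare_intCast_residue_of_absNorm_eq_sq v hℓ h r) hns
    refine ⟨(r : ZMod ℓ), ?_, fun hsq ↦ hns (hmk ▸ (isSquare_intCast_residue_iff_of_absNorm_eq v hℓ hN r).2 hsq)⟩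
    -- `ℓ ∣ R(r)`: `R(r) ≡ R(θ) = 0 (mod v)` and `v ∩ ℤ = ℓℤ`
    have hRv : ((r ^ 2 + p * r + q : ℤ) : 𝓞 (realField R)) ∈ v.asIdeal := by
      have e : ((r ^ 2 + p * r + q : ℤ) : 𝓞 (realField R)) =
          -((θₒ - r) * (θₒ + r + p)) + (θₒ ^ 2 + p * θₒ + q) := by push_cast; ring
      rw [e, hrel, add_zero]
      exact v.asIdeal.neg_mem (v.asIdeal.mul_mem_right _ hθr)
    have hdvd : (ℓ : ℤ) ∣ r ^ 2 + p * r + q := by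
      by_contra hnd
      exact intCast_notMem_of_isCoprime v ((Prime.coprime_iff_not_dvd hℓZ).2 hnd) hℓv' hRv
    have := (ZMod.intCast_zmod_eq_zero_iff_dvd _ ℓ).2 hdvd
    push_cast at this
    exact this
  · rintro ⟨r₀, hr₀, hns₀⟩
    obtain ⟨r₁, rfl⟩ := ZMod.intCast_surjective r₀
    -- `ℓ ∣ R(r₁)`; re-choose the lift with `ℓ ∥ R(r)` (part 14)
    have hR₁ : (ℓ : ℤ) ∣ r₁ ^ 2 + p * r₁ + q := by
      rw [← ZMod.intCast_zmod_eq_zero_iff_dvd]; push_cast; exact hr₀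
    have hsd : (ℓ : ℤ) ∣ (2 * r₁ + p) * (2 * r₁ + p) - (p ^ 2 - 4 * q) := by
      have e : (2 * r₁ + p) * (2 * r₁ + p) - (p ^ 2 - 4 * q) = 4 * (r₁ ^ 2 + p * r₁ + q) := by ring
      rw [e]; exact Dvd.dvd.mul_left hR₁ 4
    obtain ⟨r, hrs, hRr, hR2⟩ := exists_root_mod_of_sq_sub_disc_dvd hℓ hℓ2 hdisc hsd
    have hrr₁ : (r : ZMod ℓ) = (r₁ : ZMod ℓ) := by
      have h2 : (ℓ : ℤ) ∣ 2 * (r - r₁) := by have := hrs; rw [show 2 * r + p - (2 * r₁ + p) = 2 * (r - r₁) by ring] at this; exact this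
      have h2' : ¬ (ℓ : ℤ) ∣ 2 := fun h ↦ by
        have := Int.le_of_dvd (by norm_num) h; have := hℓ.two_le; omega
      have h3 : (ℓ : ℤ) ∣ r - r₁ := (hℓZ.dvd_or_dvd h2).resolve_left h2'
      have := (ZMod.intCast_zmod_eq_zero_iff_dvd _ ℓ).2 h3
      push_cast at this
      exact sub_eq_zero.1 this
    obtain ⟨m₁, hm₁⟩ := hRr
    have hm₁ℓ : ¬ (ℓ : ℤ) ∣ m₁ := fun h ↦ hR2 (by rw [hm₁, sq]; exact mul_dvd_mul_left _ h)
    have h2rp : ¬ (ℓ : ℤ) ∣ 2 * r + p := fun h ↦ hdisc (by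
      have e : p ^ 2 - 4 * q = (2 * r + p) * (2 * r + p) - 4 * (r ^ 2 + p * r + q) := by ring
      rw [e, hm₁]
      exact dvd_sub (dvd_mul_of_dvd_left h _) (Dvd.dvd.mul_left (dvd_mul_right _ _) _))
    -- the elements `x = θₒ - r`, `x' = -θₒ - r - p`: `x x' = R(r) = ℓ m₁`
    set x : 𝓞 (realField R) := θₒ - r with hx
    set x' : 𝓞 (realField R) := -θₒ - r - p with hx'
    have hxx' : x * x' = ℓ * m₁ := by
      have e : ((ℓ : ℤ) : 𝓞 (realField R)) * (m₁ : 𝓞 (realField R)) = ((r ^ 2 + p * r + q : ℤ) : 𝓞 (realField R)) := by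
        rw [hm₁]; push_cast; ring
      rw [hx, hx', show (ℓ : 𝓞 (realField R)) = ((ℓ : ℤ) : 𝓞 (realField R)) by push_cast; rfl, e]
      push_cast
      linear_combination (-1 : 𝓞 (realField R)) * hrel
    have hNx : (Algebra.norm ℤ x).natAbs = ℓ * m₁.natAbs := by
      rw [hx, norm_int_root_sub_intCast hR hθ r, hm₁, Int.natAbs_mul, Int.natAbs_natCast]
    have hNx' : ¬ ((ℓ : ℤ) ^ 2) ∣ Algebra.norm ℤ x' := by
      rw [hx', norm_int_neg_root_sub_intCast_sub hR hθ r]; exact hR2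
    have hm₁' : ¬ ℓ ∣ m₁.natAbs := fun h ↦ hm₁ℓ (Int.natCast_dvd.2 h)
    -- the degree-one place `𝔭 = (ℓ, x)`
    obtain ⟨v, hv, hNv, hℓv, hxv⟩ := exists_place_absNorm_eq_of_norm hK hℓ hxx' hNx' hNx hm₁'
    have hℓv' : ((ℓ : ℤ) : 𝓞 (realField R)) ∈ v.asIdeal := by push_cast; exact hℓv
    have h2rpv : ((2 * r + p : ℤ) : 𝓞 (realField R)) ∉ v.asIdeal :=
      intCast_notMem_of_isCoprime v ((Prime.coprime_iff_not_dvd hℓZ).2 h2rp) hℓv'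
    have hx'v : x' ∉ v.asIdeal := fun h ↦ h2rpv (by
      have e : ((2 * r + p : ℤ) : 𝓞 (realField R)) = -x - x' := by rw [hx, hx']; push_cast; ring
      rw [e]; exact v.asIdeal.sub_mem (v.asIdeal.neg_mem hxv) h)
    have hm₁v : (m₁ : 𝓞 (realField R)) ∉ v.asIdeal :=
      intCast_notMem_of_isCoprime v ((Prime.coprime_iff_not_dvd hℓZ).2 hm₁ℓ) hℓv'
    have hord := intValuation_natCast_eq_exp_neg_one_of_place v hv hxx' hx'v hm₁v
    have hmk : Ideal.Quotient.mk v.asIdeal θₒ = Ideal.Quotient.mk v.asIdeal (r : 𝓞 (realField R)) := by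
      rw [Ideal.Quotient.eq]; exact hxv
    refine ⟨v, ?_, ?_, ?_, ?_⟩
    · -- `2 ∉ v` (`ℓ` odd)
      have h2 : ¬ (ℓ : ℤ) ∣ 2 := fun h ↦ by
        have := Int.le_of_dvd (by norm_num) h
        have h1 := hℓ.two_le
        omega
      have := intCast_notMem_of_isCoprime v ((Prime.coprime_iff_not_dvd hℓZ).2 h2) hℓv'
      push_cast at this
      exact this
    · -- `θₒ ∉ v` (`ℓ ∤ q`)
      intro h
      exact intCast_notMem_of_isCoprime v ((Prime.coprime_iff_not_dvd hℓZ).2 hℓq) hℓv'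
        (intCast_mem_of_root_mem hR hθ v h)
    · -- `θ ≡ r` is a non-square mod `v` (`N v = ℓ`)
      rw [hmk]
      exact fun hsq ↦ hns₀ (hrr₁ ▸ (isSquare_intCast_residue_iff_of_absNorm_eq v hℓ hNv r).1 hsq)
    · rw [show (ℓ : realField R) = algebraMap (𝓞 (realField R)) (realField R) (ℓ : 𝓞 (realField R)) by
        rw [map_natCast], HeightOneSpectrum.valuation_of_algebraMap, hord, WithZero.log_exp]
      decide

/-! ### §57 The forms used by the instances: one character for all roots -/

/-- **THEOREM (character form).** Under the hypotheses of
`mk_natCast_ne_splitDiscriminantClassCM_iff_exists_root_not_isSquare`, if EVERY root `r̄ ∈ 𝔽_ℓ` of `S² + pS + q` has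
«`r̄` is a square ⟺ `P`» for one proposition `P` (e.g. a congruence on `ℓ`), then **`[ℓ] ≠ [(-1)^k] ⟺ ¬ P`**
(a root exists: `r̄ = (s̄ - p)/2`, `s̄² = p² - 4q`). [cite: Deligne1982HodgeCycles, §4 (1) and Cor. 4.2]
[cite: Omeara1963, §63B Example 63:12 and §71D Thm. 71:18] -/
theorem mk_natCast_ne_splitDiscriminantClassCM_iff_of_root_character {p q : ℤ}
    (hR : R = X ^ 2 + C p * X + C q)
    (hroots : ∀ s : ℂ, Polynomial.eval₂ (Int.castRingHom ℂ) s R = 0 → s.im = 0 ∧ s.re < 0)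
    {θₒ : 𝓞 (realField R)} (hθ : (θₒ : realField R) = AdjoinRoot.root (realPolyQ R))
    (huniq : ∀ v v' : HeightOneSpectrum (𝓞 (realField R)),
      (2 : 𝓞 (realField R)) ∈ v.asIdeal → (2 : 𝓞 (realField R)) ∈ v'.asIdeal → v = v')
    {ℓ : ℕ} (hℓ : ℓ.Prime) (hℓ2 : ℓ ≠ 2) (hℓq : ¬ (ℓ : ℤ) ∣ q) (hdisc : ¬ (ℓ : ℤ) ∣ p ^ 2 - 4 * q)
    (hdsq : IsSquare ((p ^ 2 - 4 * q : ℤ) : ZMod ℓ))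
    (hb : ∀ v : HeightOneSpectrum (𝓞 (realField R)), (2 : 𝓞 (realField R)) ∉ v.asIdeal → θₒ ∈ v.asIdeal →
      (ℓ : 𝓞 (realField R)) ∉ v.asIdeal ∧
        (IsSquare (Ideal.Quotient.mk v.asIdeal (ℓ : 𝓞 (realField R))) ∨
          ¬ Odd (WithZero.log (v.valuation (realField R) ((θₒ : 𝓞 (realField R)) : realField R)))))
    {P : Prop} (hchar : ∀ r : ZMod ℓ, r ^ 2 + (p : ZMod ℓ) * r + (q : ZMod ℓ) = 0 → (IsSquare r ↔ P))
    (qℓ : (realField R)ˣ) (hqℓ : (qℓ : realField R) = ℓ) {k : ℕ} (hk : Even k) :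
    (QuotientGroup.mk qℓ : cmNormResidueGroup R) ≠ splitDiscriminantClassCM R k ↔ ¬ P := by
  haveI := Fact.mk hℓ
  rw [mk_natCast_ne_splitDiscriminantClassCM_iff_exists_root_not_isSquare hR hroots hθ huniq hℓ hℓ2 hℓq hdisc hdsq hb
    qℓ hqℓ hk]
  constructor
  · rintro ⟨r, hr, hns⟩
    exact fun hP ↦ hns ((hchar r hr).2 hP)
  · intro hP
    -- a root `(s - p)/2`
    have h2 : (2 : ZMod ℓ) ≠ 0 := by exact_mod_cast natCast_prime_ne_zero_zmod Nat.prime_two hℓ2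
    obtain ⟨s, hs⟩ := hdsq
    refine ⟨(s - p) / 2, ?_, fun hsq ↦ hP ((hchar _ ?_).1 hsq)⟩ <;>
    · field_simp
      push_cast at hs
      linear_combination -hs

/-- **THEOREM («all roots» form, the Galois carriers).** Under the same hypotheses, if moreover `q` is a SQUARE mod
`ℓ` (the cyclic and biquadratic carriers at a split `ℓ`: `q = N_{F/ℚ}(θ) ∈ d·ℚ²` resp. `ℚ²`), the two roots
`r̄, q̄/r̄` have the same character and **`[ℓ] ≠ [(-1)^k] ⟺` EVERY root of `S² + pS + q` in `𝔽_ℓ` is a non-square**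
(«both places over `ℓ` are inert in `E`»). [cite: Deligne1982HodgeCycles, §4 (1) and Cor. 4.2]
[cite: Omeara1963, §63B Example 63:12 and §71D Thm. 71:18] -/
theorem mk_natCast_ne_splitDiscriminantClassCM_iff_forall_root_not_isSquare {p q : ℤ}
    (hR : R = X ^ 2 + C p * X + C q)
    (hroots : ∀ s : ℂ, Polynomial.eval₂ (Int.castRingHom ℂ) s R = 0 → s.im = 0 ∧ s.re < 0)
    {θₒ : 𝓞 (realField R)} (hθ : (θₒ : realField R) = AdjoinRoot.root (realPolyQ R))
    (huniq : ∀ v v' : HeightOneSpectrum (𝓞 (realField R)),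
      (2 : 𝓞 (realField R)) ∈ v.asIdeal → (2 : 𝓞 (realField R)) ∈ v'.asIdeal → v = v')
    {ℓ : ℕ} (hℓ : ℓ.Prime) (hℓ2 : ℓ ≠ 2) (hℓq : ¬ (ℓ : ℤ) ∣ q) (hdisc : ¬ (ℓ : ℤ) ∣ p ^ 2 - 4 * q)
    (hdsq : IsSquare ((p ^ 2 - 4 * q : ℤ) : ZMod ℓ)) (hqsq : IsSquare ((q : ℤ) : ZMod ℓ))
    (hb : ∀ v : HeightOneSpectrum (𝓞 (realField R)), (2 : 𝓞 (realField R)) ∉ v.asIdeal → θₒ ∈ v.asIdeal →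
      (ℓ : 𝓞 (realField R)) ∉ v.asIdeal ∧
        (IsSquare (Ideal.Quotient.mk v.asIdeal (ℓ : 𝓞 (realField R))) ∨
          ¬ Odd (WithZero.log (v.valuation (realField R) ((θₒ : 𝓞 (realField R)) : realField R)))))
    (qℓ : (realField R)ˣ) (hqℓ : (qℓ : realField R) = ℓ) {k : ℕ} (hk : Even k) :
    (QuotientGroup.mk qℓ : cmNormResidueGroup R) ≠ splitDiscriminantClassCM R k ↔
      ∀ r : ZMod ℓ, r ^ 2 + (p : ZMod ℓ) * r + (q : ZMod ℓ) = 0 → ¬ IsSquare r := by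
  haveI := Fact.mk hℓ
  have h2 : (2 : ZMod ℓ) ≠ 0 := by exact_mod_cast natCast_prime_ne_zero_zmod Nat.prime_two hℓ2
  have hq0 : ((q : ℤ) : ZMod ℓ) ≠ 0 := by
    rw [Ne, ZMod.intCast_zmod_eq_zero_iff_dvd]; exact hℓq
  -- one root `r₀`; every root is `r₀` or `q/r₀`, of the same character
  obtain ⟨s, hs⟩ := id hdsq
  push_cast at hs
  set r₀ : ZMod ℓ := (s - p) / 2 with hr₀def
  have hr₀ : r₀ ^ 2 + (p : ZMod ℓ) * r₀ + (q : ZMod ℓ) = 0 := by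
    rw [hr₀def]; field_simp; linear_combination -hs
  have hr₀0 : r₀ ≠ 0 := fun h ↦ hq0 (by rw [h] at hr₀; linear_combination hr₀)
  have hchar : ∀ r : ZMod ℓ, r ^ 2 + (p : ZMod ℓ) * r + (q : ZMod ℓ) = 0 → (IsSquare r ↔ IsSquare r₀) := by
    intro r hr
    have hprod : (r - r₀) * (r + r₀ + p) = 0 := by linear_combination hr - hr₀
    rcases mul_eq_zero.1 hprod with h | h
    · rw [sub_eq_zero.1 h]
    · have hrr₀ : r * r₀ = (q : ZMod ℓ) := by linear_combination r₀ * h - hr₀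
      have hr' : r = (q : ZMod ℓ) * r₀⁻¹ := by rw [← hrr₀, mul_inv_cancel_right₀ hr₀0]
      rw [hr']
      constructor
      · intro h1
        have h3 := h1.mul hqsq.inv
        have e : (q : ZMod ℓ) * r₀⁻¹ * ((q : ℤ) : ZMod ℓ)⁻¹ = r₀⁻¹ := by field_simp
        rw [e, isSquare_inv] at h3
        exact h3
      · intro h1
        exact hqsq.mul h1.inv
  rw [mk_natCast_ne_splitDiscriminantClassCM_iff_of_root_character hR hroots hθ huniq hℓ hℓ2 hℓq hdisc hdsq hb hchar
    qℓ hqℓ hk]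
  constructor
  · intro hP r hr hsq
    exact hP ((hchar r hr).1 hsq)
  · intro h hsq
    exact h r₀ hr₀ hsq

end Summit.HodgeConjecture.HodgeConjecture.Ring2.WeilCoverageCM

end
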